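import Literature.NumberTheory.Sieve.AffineLatticeLocalDensities
import Literature.NumberTheory.Sieve.AffineLatticeRealBounds
import Literature.NumberTheory.Sieve.PrimeParallelograms
import Literature.NumberTheory.Sieve.LinearEquationsInPrimesComplexityNormalForm
import Literature.NumberTheory.Sieve.LinearEquationsInPrimesMainReduction
import Literature.NumberTheory.Sieve.ConvexBodyLatticePoints
import Literature.NumberTheory.Sieve.LinearEquationsInPrimesLevelTwoAllSystems
import HarnessLib

/-!
# Green–Tao 2010, Theorem 1.8 — linear equations in primes, EQUATION form, at Cauchy–Schwarz complexity `s` (module M2 of rung F-CS1-eq)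

Topic `Literature/NumberTheory/Sieve`. Source: B. Green, T. Tao, *Linear equations in primes*,
Ann. of Math. 171 (2010), Thm. 1.8 (arXiv:math/0606088 p. 8) and its derivation from the Main
Theorem in §4 (p. 11).

**Theorem 1.8 (as printed).** "Let `A = (a_{ij})` be an `s × t` matrix of integers, where `s ≤ t`.
Assume that `A` has full rank `s`, and further assume that the only element of the row-space of
`A` over `ℚ` with two or fewer non-zero entries is the zero vector. Let `N > 1`, let
`b = (b₁, …, b_s) ∈ Aℤ^t`, and suppose the coefficients satisfy `|a_{ij}| ≤ L` and `|bᵢ| ≤ LN`.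
Let `K ⊆ [−N, N]^t` be convex. Then
`∑_{x ∈ ℤ^t ∩ K, Ax = b} ∏_{i∈[t]} Λ(xᵢ) = α_∞ ∏_p α_p + o_{t,L,s}(N^{t−s})`, where
`α_p := lim_{M→∞} 𝔼_{x ∈ [−M,M]^t, Ax = b} ∏ Λ_{ℤ_p}(xᵢ)` and
`α_∞ := #{x ∈ ℤ^t ∩ K : Ax = b, xᵢ ≥ 0}`."

Green–Tao prove it from the Main Theorem for systems of complexity `s` (they assume `GI(s)`,
`MN(s)`). We render it per complexity level as `GreenTao2010_theorem18AtComplexity s` (with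
`s < t`: for `s = t` the affine lattice is a point and `∏_p α_p` diverges, a case the printed
statement tacitly excludes) and prove

* **`GreenTao2010_theorem18_of_mainTheoremAtComplexity (s)`**:
  `GreenTao2010_mainTheoremAtComplexity s → GreenTao2010_theorem18AtComplexity s` — the §4
  derivation: parametrise `Γ = {Ax = b} = Ψ(ℤ^{t−s})` (`AffineLatticeParametrisation`),
  `complexity Ψ ≤ s` (`…Complexity`), `α_p = β_p` (`AffineLatticeLocalDensities`),
  `K' = Ψ_ℝ⁻¹(K) ⊆ [−N', N']^{t−s}` (`AffineLatticeRealBounds`), and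
  `α_∞ = β_∞ + O(N^{t−s−1})` by the lattice-point count in convex bodies
  (`GreenTao2010_latticePointsConvexBody_holds`, Appendix A) plus the elementary bound
  `#{n ∈ box : ψᵢ(n) = 0} ≤ (2N'+1)^{t−s−1}` for the boundary faces `xᵢ = 0`;
* **`GreenTao2010_theorem18AtComplexity_one`** — UNCONDITIONAL at `s = 1` (one linear equation
  `a₁x₁ + ⋯ + a_t x_t = b` in primes, `t ≥ 2`… with the row-space condition forcing `t ≥ 3` and all
  `aᵢ ≠ 0`), from `GreenTao2010_mainTheoremAtComplexity_one`.

`α_p` is `equationLocalFactor A b p` (the average over the residues `Γ_p`, which Green–Tao's box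
limit computes by periodicity), `∏_p α_p` is `equationSingularProduct A b` (ordered limit,
D-SIEVE-1), `α_∞` is `equationArchCount A b K N`.

## References

* [GreenTao2010] B. Green, T. Tao, *Linear equations in primes*, Ann. of Math. (2) 171 (2010),
  Thm. 1.8, §4 (derivation of Thm. 1.8), App. A.
-/

noncomputable section

open Finset MeasureTheory
open scoped Matrix

namespace Literature.NumberTheory.Sieve

variable {s t : ℕ}

/-! ### The quantities of Theorem 1.8 -/

open Classical in
/-- `∑_{x ∈ ℤ^t ∩ K, Ax = b} ∏ᵢ Λ(xᵢ)` for `K ⊆ [−N, N]^t`. [cite: GreenTao2010, Thm. 1.8] -/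
def equationVonMangoldtSum (A : Matrix (Fin s) (Fin t) ℤ) (b : Fin s → ℤ) (K : Set (Fin t → ℝ))
    (N : ℕ) : ℝ :=
  ∑ x ∈ (latticeBox t N).filter (fun x => realPoint x ∈ K ∧ A *ᵥ x = b),
    ∏ i, intVonMangoldt (x i)

open Classical in
/-- `α_∞ = #{x ∈ ℤ^t ∩ K : Ax = b, xᵢ ≥ 0}` for `K ⊆ [−N, N]^t`. [cite: GreenTao2010, Thm. 1.8] -/
def equationArchCount (A : Matrix (Fin s) (Fin t) ℤ) (b : Fin s → ℤ) (K : Set (Fin t → ℝ))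
    (N : ℕ) : ℕ :=
  #((latticeBox t N).filter fun x => realPoint x ∈ K ∧ A *ᵥ x = b ∧ ∀ i, 0 ≤ x i)

/-- **Green–Tao 2010, Theorem 1.8, at Cauchy–Schwarz complexity `s`** (`1 ≤ t − s`): for all
`t > s`, `L` and `ε > 0` there is `N₀` such that for all `N ≥ N₀`, all integer `s × t` matrices
`A` of full rank `s` with `|a_{ij}| ≤ L` whose rational row space contains no non-zero vector with
at most two non-zero entries, all `b ∈ Aℤ^t` with `|bᵢ| ≤ LN` and all convex `K ⊆ [−N, N]^t`,
`|∑_{x ∈ ℤ^t ∩ K, Ax = b} ∏ᵢ Λ(xᵢ) − α_∞ ∏_p α_p| ≤ ε N^{t−s}`.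
[cite: GreenTao2010, Thm. 1.8] -/
def GreenTao2010_theorem18AtComplexity (s : ℕ) : Prop :=
  ∀ (t L : ℕ), s < t → ∀ ε : ℝ, 0 < ε → ∃ N₀ : ℕ, ∀ N : ℕ, N₀ ≤ N →
    ∀ A : Matrix (Fin s) (Fin t) ℤ, (ratMat A).rank = s → (∀ i j, |A i j| ≤ L) →
      RowSpaceNondegenerate A →
      ∀ b : Fin s → ℤ, (∃ x : Fin t → ℤ, A *ᵥ x = b) → (∀ k, |b k| ≤ L * N) →
        ∀ K : Set (Fin t → ℝ), Convex ℝ K → K ⊆ realBox t N →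
          |equationVonMangoldtSum A b K N -
              equationArchCount A b K N * equationSingularProduct A b| ≤ ε * (N : ℝ) ^ (t - s)

/-! ### Boxes -/

/-- [folklore] -/
private theorem abs_le_of_mem_realBox {d : ℕ} {N : ℝ} {x : Fin d → ℝ} (hx : x ∈ realBox d N)
    (i : Fin d) : |x i| ≤ N :=
  abs_le.mpr ⟨hx.1 i, hx.2 i⟩

/-- [folklore] -/
private theorem mem_realBox_of_abs_le {d : ℕ} {N : ℝ} {x : Fin d → ℝ} (hx : ∀ i, |x i| ≤ N) :
    x ∈ realBox d N :=
  ⟨fun i => (abs_le.mp (hx i)).1, fun i => (abs_le.mp (hx i)).2⟩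

/-- [folklore] -/
private theorem mem_latticeBox_iff {d N : ℕ} {x : Fin d → ℤ} :
    x ∈ latticeBox d N ↔ ∀ j, |x j| ≤ N := by
  unfold latticeBox
  rw [Fintype.mem_piFinset]
  exact forall_congr' fun j => by rw [Finset.mem_Icc, abs_le]

/-- [folklore] -/
private theorem mem_latticeBox_of_realPoint_mem {d N : ℕ} {x : Fin d → ℤ}
    (hx : realPoint x ∈ realBox d (N : ℝ)) : x ∈ latticeBox d N :=
  mem_latticeBox_iff.mpr fun j => by
    have h := abs_le_of_mem_realBox hx j
    simp only [realPoint] at h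
    exact_mod_cast h

/-! ### Preimages of convex sets under the real extension of a system are convex -/

/-- The real extension `x ↦ (ψ₁(x), …, ψ_t(x))` of a system. [cite: GreenTao2010, Def. 1.1] -/
def realMap {d : ℕ} (Ψ : Fin t → AffLinForm d) (x : Fin d → ℝ) : Fin t → ℝ :=
  fun i => (Ψ i).realEval x

/-- The real extension is affine. [cite: GreenTao2010, Def. 1.1] -/
theorem realMap_convexComb {d : ℕ} (Ψ : Fin t → AffLinForm d) (x y : Fin d → ℝ) {a b : ℝ}
    (hab : a + b = 1) : realMap Ψ (a • x + b • y) = a • realMap Ψ x + b • realMap Ψ y := by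
  funext i
  simp only [realMap, AffLinForm.realEval, Pi.add_apply, Pi.smul_apply, smul_eq_mul]
  have e1 : ∑ j, ((Ψ i).coeff j : ℝ) * (a * x j + b * y j) =
      a * ∑ j, ((Ψ i).coeff j : ℝ) * x j + b * ∑ j, ((Ψ i).coeff j : ℝ) * y j := by
    rw [Finset.mul_sum, Finset.mul_sum, ← Finset.sum_add_distrib]
    exact Finset.sum_congr rfl fun j _ => by ring
  rw [e1]
  have hc : ((Ψ i).const : ℝ) = (a + b) * (Ψ i).const := by rw [hab, one_mul]
  linear_combination hc

/-- **Preimages of convex sets under `Ψ_ℝ` are convex.** [cite: GreenTao2010, §4 (derivation of Thm. 1.8)] -/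
theorem convex_preimage_realMap {d : ℕ} (Ψ : Fin t → AffLinForm d) {S : Set (Fin t → ℝ)}
    (hS : Convex ℝ S) : Convex ℝ {x : Fin d → ℝ | realMap Ψ x ∈ S} := by
  intro x hx y hy a b ha hb hab
  show realMap Ψ (a • x + b • y) ∈ S
  rw [realMap_convexComb Ψ x y hab]
  exact hS hx hy ha hb hab

/-- The positive orthant is convex. [folklore] -/
private theorem convex_posOrthant (t : ℕ) : Convex ℝ {x : Fin t → ℝ | ∀ i, 0 < x i} := by
  intro x hx y hy a b ha hb hab i
  simp only [Pi.add_apply, Pi.smul_apply, smul_eq_mul]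
  rcases ha.lt_or_eq with ha' | ha'
  · exact add_pos_of_pos_of_nonneg (mul_pos ha' (hx i)) (mul_nonneg hb (hy i).le)
  · rw [← ha', zero_mul, zero_add]
    rw [← ha', zero_add] at hab
    rw [hab, one_mul]
    exact hy i

/-- The closed positive orthant is convex. [folklore] -/
private theorem convex_nonnegOrthant (t : ℕ) : Convex ℝ {x : Fin t → ℝ | ∀ i, 0 ≤ x i} := by
  intro x hx y hy a b ha hb _ i
  simp only [Pi.add_apply, Pi.smul_apply, smul_eq_mul]
  exact add_nonneg (mul_nonneg ha (hx i)) (mul_nonneg hb (hy i))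

/-! ### Transport of the three quantities along the parametrisation -/

section Transport

open Classical

variable {A : Matrix (Fin s) (Fin t) ℤ} {x₀ : Fin t → ℤ} {b : Fin s → ℤ} {K : Set (Fin t → ℝ)}
  {N N' : ℕ}

/-- Lattice points `c` with `Ψ(c) ∈ K ⊆ [−N, N]^t` correspond to the points of `Γ ∩ K`:
the von Mangoldt sum of the parametrising system over `K' = Ψ_ℝ⁻¹(K)` is the equation sum.
[cite: GreenTao2010, §4 (derivation of Thm. 1.8)] -/
theorem vonMangoldtSum_paramSystem_eq (hx₀ : A *ᵥ x₀ = b) (hK : K ⊆ realBox t (N : ℝ))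
    (hK' : {c : Fin (kerDim A) → ℝ | realMap (paramSystem A x₀) c ∈ K} ⊆ realBox (kerDim A) (N' : ℝ)) :
    vonMangoldtSum (paramSystem A x₀) {c | realMap (paramSystem A x₀) c ∈ K} N' =
      equationVonMangoldtSum A b K N := by
  classical
  unfold vonMangoldtSum equationVonMangoldtSum
  refine Finset.sum_nbij (paramPoint A x₀) ?_ ?_ ?_ ?_
  · intro c hc
    rw [Finset.mem_filter] at hc ⊢
    have hcK : realPoint (paramPoint A x₀ c) ∈ K := by
      rw [realPoint_paramPoint]; exact hc.2
    exact ⟨mem_latticeBox_of_realPoint_mem (hK hcK), hcK, by rw [mulVec_paramPoint, hx₀]⟩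
  · exact fun c _ c' _ h => paramPoint_injective A x₀ h
  · intro x hx
    rw [Finset.mem_coe, Finset.mem_filter] at hx
    obtain ⟨-, hxK, hxb⟩ := hx
    obtain ⟨c, hc⟩ := exists_paramPoint_eq (A := A) (x₀ := x₀) (x := x) (by rw [hxb, hx₀])
    have hcK : realMap (paramSystem A x₀) (realPoint c) ∈ K := by
      rw [show realMap (paramSystem A x₀) (realPoint c) = realPoint (paramPoint A x₀ c) from
        (realPoint_paramPoint A x₀ c).symm, hc]; exact hxK
    refine ⟨c, ?_, hc⟩
    rw [Finset.mem_coe, Finset.mem_filter]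
    exact ⟨mem_latticeBox_of_realPoint_mem (hK' hcK), hcK⟩
  · intro c _
    exact Finset.prod_congr rfl fun i _ => by rw [eval_paramSystem]

/-- The count `α_∞` is the number of lattice points of the convex set
`K'' = Ψ_ℝ⁻¹(K ∩ [0, ∞)^t)`. [cite: GreenTao2010, §4 (derivation of Thm. 1.8)] -/
theorem equationArchCount_eq_card (hx₀ : A *ᵥ x₀ = b) (hK : K ⊆ realBox t (N : ℝ))
    (hK' : {c : Fin (kerDim A) → ℝ | realMap (paramSystem A x₀) c ∈ K} ⊆ realBox (kerDim A) (N' : ℝ)) :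
    equationArchCount A b K N =
      #((latticeBox (kerDim A) N').filter fun c =>
          realPoint c ∈ {c | realMap (paramSystem A x₀) c ∈ K ∩ {x | ∀ i, 0 ≤ x i}}) := by
  classical
  unfold equationArchCount
  refine (Finset.card_nbij (paramPoint A x₀) ?_ ?_ ?_).symm
  · intro c hc
    rw [Finset.mem_coe, Finset.mem_filter] at hc ⊢
    obtain ⟨-, hcK, hpos⟩ := hc
    have hcK' : realPoint (paramPoint A x₀ c) ∈ K := by rw [realPoint_paramPoint]; exact hcK
    refine ⟨mem_latticeBox_of_realPoint_mem (hK hcK'), hcK', by rw [mulVec_paramPoint, hx₀],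
      fun i => ?_⟩
    have := hpos i
    rw [realMap, realEval_paramSystem_realPoint] at this
    exact_mod_cast this
  · exact fun c _ c' _ h => paramPoint_injective A x₀ h
  · intro x hx
    rw [Finset.mem_coe, Finset.mem_filter] at hx
    obtain ⟨-, hxK, hxb, hpos⟩ := hx
    obtain ⟨c, hc⟩ := exists_paramPoint_eq (A := A) (x₀ := x₀) (x := x) (by rw [hxb, hx₀])
    have hcK : realMap (paramSystem A x₀) (realPoint c) ∈ K := by
      rw [show realMap (paramSystem A x₀) (realPoint c) = realPoint (paramPoint A x₀ c) from
        (realPoint_paramPoint A x₀ c).symm, hc]; exact hxK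
    refine ⟨c, ?_, hc⟩
    rw [Finset.mem_coe, Finset.mem_filter]
    refine ⟨mem_latticeBox_of_realPoint_mem (hK' hcK), hcK, fun i => ?_⟩
    show (0 : ℝ) ≤ (paramSystem A x₀ i).realEval (realPoint c)
    rw [realEval_paramSystem_realPoint, hc]
    exact_mod_cast hpos i

/-- The open count `#{c ∈ box : Ψ(c) ∈ K, ψᵢ(c) > 0 ∀ i}` — the lattice points of the convex set
`K' ∩ {Ψ_ℝ > 0}` whose volume is `β_∞`. [cite: GreenTao2010, §4 (derivation of Thm. 1.8)] -/
def posCount (A : Matrix (Fin s) (Fin t) ℤ) (x₀ : Fin t → ℤ) (K : Set (Fin t → ℝ)) (N' : ℕ) : ℕ :=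
  #((latticeBox (kerDim A) N').filter fun c =>
      realPoint c ∈ {c | realMap (paramSystem A x₀) c ∈ K ∩ {x | ∀ i, 0 < x i}})

/-- Lattice points of the box on the face `ψᵢ = 0`: at most `(2N'+1)^{n-1}` (the coordinate `j₀`
with `ψ̇ᵢ(e_{j₀}) ≠ 0` is determined by the others). [cite: GreenTao2010, §4 (derivation of Thm. 1.8)] -/
theorem card_face_le {n : ℕ} (ψ : AffLinForm n) (hψ : ψ.coeff ≠ 0) (N' : ℕ) :
    #((latticeBox n N').filter fun c => ψ.eval c = 0) ≤ (2 * N' + 1) ^ (n - 1) := by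
  classical
  obtain ⟨j₀, hj₀⟩ : ∃ j₀, ψ.coeff j₀ ≠ 0 := by
    by_contra h
    push Not at h
    exact hψ (funext h)
  have hn : 1 ≤ n := Nat.one_le_iff_ne_zero.mpr fun h0 => by subst h0; exact Fin.elim0 j₀
  set T : Finset (Fin n → ℤ) :=
    Fintype.piFinset (Function.update (fun _ : Fin n => Icc (-(N' : ℤ)) N') j₀ {0}) with hT
  have hTcard : #T = (2 * N' + 1) ^ (n - 1) := by
    rw [hT, Fintype.card_piFinset]
    have h1 : ∀ j, #(Function.update (fun _ : Fin n => Icc (-(N' : ℤ)) N') j₀ {0} j) =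
        Function.update (fun _ : Fin n => 2 * N' + 1) j₀ 1 j := fun j => by
      by_cases h : j = j₀
      · subst h; simp
      · rw [Function.update_of_ne h, Function.update_of_ne h, Int.card_Icc]
        rw [show (N' : ℤ) + 1 - -(N' : ℤ) = ((2 * N' + 1 : ℕ) : ℤ) by push_cast; ring,
          Int.toNat_natCast]
    rw [Finset.prod_congr rfl fun j _ => h1 j, Finset.prod_update_of_mem (Finset.mem_univ j₀),
      one_mul, Finset.prod_const]
    congr 1
    rw [Finset.sdiff_singleton_eq_erase, Finset.card_erase_of_mem (Finset.mem_univ _),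
      Finset.card_univ, Fintype.card_fin]
  rw [← hTcard]
  refine Finset.card_le_card_of_injOn (fun c => Function.update c j₀ 0) ?_ ?_
  · intro c hc
    rw [Finset.mem_coe, Finset.mem_filter, mem_latticeBox_iff] at hc
    rw [Finset.mem_coe, hT, Fintype.mem_piFinset]
    intro j
    dsimp only
    by_cases h : j = j₀
    · subst h; simp
    · rw [Function.update_of_ne h, Function.update_of_ne h, Finset.mem_Icc, ← abs_le]
      exact hc.1 j
  · intro c hc c' hc' heq
    rw [Finset.mem_coe, Finset.mem_filter] at hc hc'
    have hother : ∀ j, j ≠ j₀ → c j = c' j := fun j hj => by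
      have := congr_fun heq j
      dsimp only at this
      rwa [Function.update_of_ne hj, Function.update_of_ne hj] at this
    have hsum : ψ.coeff j₀ * c j₀ = ψ.coeff j₀ * c' j₀ := by
      have h1 := hc.2
      have h2 := hc'.2
      unfold AffLinForm.eval at h1 h2
      rw [← Finset.add_sum_erase _ _ (Finset.mem_univ j₀)] at h1 h2
      have h3 : ∑ j ∈ Finset.univ.erase j₀, ψ.coeff j * c j =
          ∑ j ∈ Finset.univ.erase j₀, ψ.coeff j * c' j :=
        Finset.sum_congr rfl fun j hj => by rw [hother j (Finset.ne_of_mem_erase hj)]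
      linarith
    funext j
    by_cases h : j = j₀
    · subst h; exact mul_left_cancel₀ hj₀ hsum
    · exact hother j h

/-- `α_∞` versus the open count: `0 ≤ α_∞ − posCount ≤ t (2N'+1)^{n−1}`.
[cite: GreenTao2010, §4 (derivation of Thm. 1.8)] -/
theorem posCount_le_card_and_le (hnd : KerOrthNondegenerate A) (x₀ : Fin t → ℤ)
    (K : Set (Fin t → ℝ)) (N' : ℕ) :
    posCount A x₀ K N' ≤
        #((latticeBox (kerDim A) N').filter fun c =>
            realPoint c ∈ {c | realMap (paramSystem A x₀) c ∈ K ∩ {x | ∀ i, 0 ≤ x i}}) ∧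
      #((latticeBox (kerDim A) N').filter fun c =>
            realPoint c ∈ {c | realMap (paramSystem A x₀) c ∈ K ∩ {x | ∀ i, 0 ≤ x i}}) ≤
        posCount A x₀ K N' + t * (2 * N' + 1) ^ (kerDim A - 1) := by
  have hval : ∀ (c : Fin (kerDim A) → ℤ) i,
      realMap (paramSystem A x₀) (realPoint c) i = ((paramSystem A x₀ i).eval c : ℝ) :=
    fun c i => by
      show (paramSystem A x₀ i).realEval (realPoint c) = _
      rw [realEval_paramSystem_realPoint, eval_paramSystem]
  constructor
  · refine Finset.card_le_card fun c hc => ?_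
    rw [Finset.mem_filter] at hc
    rw [Finset.mem_filter]
    exact ⟨hc.1, hc.2.1, fun i => (hc.2.2 i).le⟩
  · -- `S≥ ⊆ S> ∪ ⋃ᵢ {ψᵢ = 0}`
    have hsub : ((latticeBox (kerDim A) N').filter fun c =>
          realPoint c ∈ {c | realMap (paramSystem A x₀) c ∈ K ∩ {x | ∀ i, 0 ≤ x i}}) ⊆
        ((latticeBox (kerDim A) N').filter fun c =>
            realPoint c ∈ {c | realMap (paramSystem A x₀) c ∈ K ∩ {x | ∀ i, 0 < x i}}) ∪
          Finset.univ.biUnion fun i =>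
            (latticeBox (kerDim A) N').filter fun c => (paramSystem A x₀ i).eval c = 0 := by
      intro c hc
      rw [Finset.mem_filter] at hc
      rw [Finset.mem_union]
      by_cases hall : ∀ i, 0 < realMap (paramSystem A x₀) (realPoint c) i
      · left
        rw [Finset.mem_filter]
        exact ⟨hc.1, hc.2.1, hall⟩
      · right
        push Not at hall
        obtain ⟨i, hi⟩ := hall
        have h0 : realMap (paramSystem A x₀) (realPoint c) i = 0 := le_antisymm hi (hc.2.2 i)
        rw [hval] at h0
        rw [Finset.mem_biUnion]
        refine ⟨i, Finset.mem_univ i, ?_⟩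
        rw [Finset.mem_filter]
        exact ⟨hc.1, by exact_mod_cast h0⟩
    refine (Finset.card_le_card hsub).trans ((Finset.card_union_le _ _).trans ?_)
    rw [posCount]
    refine add_le_add le_rfl (Finset.card_biUnion_le.trans ?_)
    calc ∑ i, #((latticeBox (kerDim A) N').filter fun c => (paramSystem A x₀ i).eval c = 0)
        ≤ ∑ _i : Fin t, (2 * N' + 1) ^ (kerDim A - 1) :=
          Finset.sum_le_sum fun i _ => card_face_le _ (coeff_paramSystem_ne_zero hnd x₀ i) N'
      _ = t * (2 * N' + 1) ^ (kerDim A - 1) := by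
          rw [Finset.sum_const, Finset.card_univ, Fintype.card_fin, smul_eq_mul]

end Transport

/-! ### Elementary bookkeeping -/

/-- [folklore] -/
private theorem abs_sub_mul_le {v a c p S e₁ e₂ e₃ B : ℝ} (h₁ : |v - a * S| ≤ e₁)
    (h₂ : |a - p| ≤ e₂) (hpc : |p - c| ≤ e₃) (hS0 : 0 ≤ S) (hSB : S ≤ B) :
    |v - c * S| ≤ e₁ + (e₂ + e₃) * B := by
  have h3 : |a - c| ≤ e₂ + e₃ := by
    calc |a - c| = |(a - p) + (p - c)| := by ring_nf
      _ ≤ |a - p| + |p - c| := abs_add_le _ _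
      _ ≤ e₂ + e₃ := add_le_add h₂ hpc
  have h0 : 0 ≤ e₂ + e₃ := (abs_nonneg _).trans h3
  calc |v - c * S| = |(v - a * S) + (a - c) * S| := by ring_nf
    _ ≤ |v - a * S| + |(a - c) * S| := abs_add_le _ _
    _ = |v - a * S| + |a - c| * S := by rw [abs_mul, abs_of_nonneg hS0]
    _ ≤ e₁ + (e₂ + e₃) * B := add_le_add h₁ (mul_le_mul h3 hSB hS0 h0)

/-- The final choice of `ε'` and `N₀`. [folklore] -/
private theorem final_bookkeeping {d : ℕ} (hd : 1 ≤ d) {C₂ Cd B : ℝ} (hC₂ : 1 ≤ C₂) (hCd : 0 ≤ Cd)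
    (hB : 0 ≤ B) (t : ℕ) {ε : ℝ} (hε : 0 < ε) :
    ∃ ε' : ℝ, 0 < ε' ∧ ∃ Nb : ℕ, 1 ≤ Nb ∧ ∀ N : ℕ, Nb ≤ N → ∀ N' : ℕ, 1 ≤ N' → (N' : ℝ) ≤ C₂ * N →
      ε' * (N' : ℝ) ^ d + (Cd * (N' : ℝ) ^ (d - 1) + t * (2 * (N' : ℝ) + 1) ^ (d - 1)) * B ≤
        ε * (N : ℝ) ^ d := by
  have hC₂0 : 0 < C₂ := by linarith
  set Q : ℝ := (Cd + t * 3 ^ (d - 1)) * B * C₂ ^ (d - 1) with hQ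
  have hQ0 : 0 ≤ Q := by positivity
  refine ⟨ε / (2 * C₂ ^ d), by positivity, ?_⟩
  obtain ⟨Nb, hNb⟩ := exists_nat_gt (2 * Q / ε)
  refine ⟨max 1 Nb, le_max_left _ _, fun N hN N' hN' hN'C => ?_⟩
  have hN1 : (1 : ℝ) ≤ N := by exact_mod_cast (le_max_left 1 Nb).trans hN
  have hNQ : 2 * Q / ε ≤ N := hNb.le.trans (by exact_mod_cast (le_max_right 1 Nb).trans hN)
  have hN'1 : (1 : ℝ) ≤ N' := by exact_mod_cast hN'
  -- first term
  have h1 : ε / (2 * C₂ ^ d) * (N' : ℝ) ^ d ≤ ε / 2 * (N : ℝ) ^ d := by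
    have : (N' : ℝ) ^ d ≤ C₂ ^ d * (N : ℝ) ^ d := by
      rw [← mul_pow]; exact pow_le_pow_left₀ (by positivity) hN'C _
    calc ε / (2 * C₂ ^ d) * (N' : ℝ) ^ d ≤ ε / (2 * C₂ ^ d) * (C₂ ^ d * (N : ℝ) ^ d) :=
          mul_le_mul_of_nonneg_left this (by positivity)
      _ = ε / 2 * (N : ℝ) ^ d := by field_simp
  -- second term
  have h2 : (Cd * (N' : ℝ) ^ (d - 1) + t * (2 * (N' : ℝ) + 1) ^ (d - 1)) * B ≤
      Q * (N : ℝ) ^ (d - 1) := by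
    have h21 : (2 * (N' : ℝ) + 1) ^ (d - 1) ≤ 3 ^ (d - 1) * (N' : ℝ) ^ (d - 1) := by
      rw [← mul_pow]; exact pow_le_pow_left₀ (by positivity) (by linarith) _
    have h22 : (N' : ℝ) ^ (d - 1) ≤ C₂ ^ (d - 1) * (N : ℝ) ^ (d - 1) := by
      rw [← mul_pow]; exact pow_le_pow_left₀ (by positivity) hN'C _
    calc (Cd * (N' : ℝ) ^ (d - 1) + t * (2 * (N' : ℝ) + 1) ^ (d - 1)) * B
        ≤ (Cd * (N' : ℝ) ^ (d - 1) + t * (3 ^ (d - 1) * (N' : ℝ) ^ (d - 1))) * B := by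
          gcongr
      _ = (Cd + t * 3 ^ (d - 1)) * B * (N' : ℝ) ^ (d - 1) := by ring
      _ ≤ (Cd + t * 3 ^ (d - 1)) * B * (C₂ ^ (d - 1) * (N : ℝ) ^ (d - 1)) :=
          mul_le_mul_of_nonneg_left h22 (by positivity)
      _ = Q * (N : ℝ) ^ (d - 1) := by rw [hQ]; ring
  have h3 : Q * (N : ℝ) ^ (d - 1) ≤ ε / 2 * (N : ℝ) ^ d := by
    have hQN : Q ≤ ε / 2 * N := by
      have := (div_le_iff₀ hε).mp hNQ
      linarith
    calc Q * (N : ℝ) ^ (d - 1) ≤ (ε / 2 * N) * (N : ℝ) ^ (d - 1) :=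
          mul_le_mul_of_nonneg_right hQN (by positivity)
      _ = ε / 2 * (N : ℝ) ^ d := by
          rw [mul_assoc, ← pow_succ', Nat.sub_add_cancel hd]
  linarith

/-! ### Theorem 1.8 from the Main Theorem: fixed matrix -/

/-- **Theorem 1.8 for a fixed matrix `A`** from the Main Theorem at complexity `s`.
[cite: GreenTao2010, §4 (derivation of Thm. 1.8)] -/
theorem GreenTao2010_theorem18_fixedMatrix (hmain : GreenTao2010_mainTheoremAtComplexity s)
    {A : Matrix (Fin s) (Fin t) ℤ} (hA : (ratMat A).rank = s) (hnd : KerOrthNondegenerate A)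
    (hst : s < t) (L : ℕ) {ε : ℝ} (hε : 0 < ε) :
    ∃ N₀ : ℕ, ∀ N : ℕ, N₀ ≤ N → ∀ b : Fin s → ℤ, (∃ x : Fin t → ℤ, A *ᵥ x = b) →
      (∀ k, |b k| ≤ L * N) → ∀ K : Set (Fin t → ℝ), Convex ℝ K → K ⊆ realBox t N →
        |equationVonMangoldtSum A b K N -
            equationArchCount A b K N * equationSingularProduct A b| ≤ ε * (N : ℝ) ^ (t - s) := by
  classical
  -- dimension `kerDim A = t - s ≥ 1`
  have hdts : kerDim A = t - s := kerDim_eq_of_rank_eq hA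
  have hd1 : 1 ≤ kerDim A := by omega
  have ht1 : 1 ≤ t := by omega
  -- constants attached to `A`
  obtain ⟨C, hC0, hpar⟩ := exists_affineLatticeParam hA
  obtain ⟨C', hC'0, hbox⟩ := exists_preimage_box_bound A
  obtain ⟨Cd, hlat⟩ := GreenTao2010_latticePointsConvexBody_holds (kerDim A) hd1
  have hCd0 : 0 ≤ Cd := by
    have h := hlat 1 le_rfl ∅ convex_empty (Set.empty_subset _)
    simp at h
    exact h
  -- uniform bound for the singular products of the parametrising systems (fixed coefficients)
  obtain ⟨B, hB0, hB⟩ := singularProduct_mem_Icc_uniform t (∑ i : Fin t, ∑ j, (kerGen A j i).natAbs)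
  have hcoeff : ∀ (x₀ : Fin t → ℤ) (i : Fin t) (j : Fin (kerDim A)),
      ((paramSystem A x₀ i).coeff j).natAbs ≤ ∑ i : Fin t, ∑ j, (kerGen A j i).natAbs := by
    intro x₀ i j
    rw [paramSystem_coeff]
    exact (Finset.single_le_sum (f := fun j' => (kerGen A j' i).natAbs) (fun _ _ => Nat.zero_le _)
      (Finset.mem_univ j)).trans
      (Finset.single_le_sum (f := fun i' => ∑ j', (kerGen A j' i').natAbs)
        (fun _ _ => Nat.zero_le _) (Finset.mem_univ i))
  -- `|x₀ᵢ| ≤ C + t X₁ N`, `N' ≤ C₂ N`, `‖Ψ‖ ≤ Lm`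
  set X₁ : ℝ := C * (1 + s * L) with hX₁
  have hX₁0 : 0 ≤ X₁ := by positivity
  set C₂ : ℝ := 2 + C' * (1 + C + t * X₁) with hC₂
  have hC₂1 : 1 ≤ C₂ := by
    have : 0 ≤ C' * (1 + C + t * X₁) := by positivity
    linarith
  set Lm : ℕ := ⌈C + t * X₁⌉₊ with hLm
  -- `ε'`, the bookkeeping threshold, and the Main Theorem at these parameters
  obtain ⟨ε', hε', Nb, hNb1, hbook⟩ := final_bookkeeping hd1 hC₂1 hCd0 hB0 t hε
  obtain ⟨N₁, hN₁⟩ := hmain (kerDim A) t Lm hd1 ht1 ε' hε'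
  refine ⟨max N₁ Nb, fun N hN b hb hbL K hKc hKN => ?_⟩
  have hNN₁ : N₁ ≤ N := (le_max_left _ _).trans hN
  have hNNb : Nb ≤ N := (le_max_right _ _).trans hN
  have hN1 : 1 ≤ N := hNb1.trans hNNb
  have hN1r : (1 : ℝ) ≤ N := by exact_mod_cast hN1
  have hN0r : (0 : ℝ) < N := by linarith
  have hbsum : ∑ k, |(b k : ℝ)| ≤ s * L * N := by
    calc ∑ k, |(b k : ℝ)| ≤ ∑ _k : Fin s, (L : ℝ) * N :=
          Finset.sum_le_sum fun k _ => by exact_mod_cast hbL k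
      _ = s * L * N := by
          rw [Finset.sum_const, Finset.card_univ, Fintype.card_fin, nsmul_eq_mul]; ring
  have hCb : C * (1 + ∑ k, |(b k : ℝ)|) ≤ X₁ * N := by
    calc C * (1 + ∑ k, |(b k : ℝ)|) ≤ C * (1 + s * L * N) := by gcongr
      _ ≤ C * ((1 + s * L) * N) := by
          refine mul_le_mul_of_nonneg_left ?_ hC0
          nlinarith [show (0 : ℝ) ≤ s * L by positivity]
      _ = X₁ * N := by rw [hX₁]; ring
  -- the parametrisation of `Γ_b` with its size bound
  obtain ⟨x₀, hx₀, -, -, -, hsize⟩ := hpar b hb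
  have hx₀bd : ∀ i, |(x₀ i : ℝ)| ≤ C + t * (X₁ * N) := by
    intro i
    have h1 := hsize 1 one_pos
    rw [affLinSize_paramSystem] at h1
    simp only [div_one] at h1
    have h2 : |(x₀ i : ℝ)| ≤ ∑ i', |(x₀ i' : ℝ)| :=
      Finset.single_le_sum (f := fun i' => |(x₀ i' : ℝ)|) (fun _ _ => abs_nonneg _)
        (Finset.mem_univ i)
    have h3 : (0 : ℝ) ≤ ∑ i : Fin t, ∑ j : Fin (kerDim A), |(kerGen A j i : ℝ)| := by positivity
    have h4 : (t : ℝ) * (C * (1 + ∑ k, |(b k : ℝ)|)) ≤ t * (X₁ * N) :=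
      mul_le_mul_of_nonneg_left hCb (by positivity)
    linarith
  -- the scale `N'`
  set Y : ℝ := C' * (N + (C + t * (X₁ * N))) with hY
  have hY0 : 0 ≤ Y := by positivity
  set N' : ℕ := max N ⌈Y⌉₊ with hN'
  have hNN' : N ≤ N' := le_max_left _ _
  have hN'1 : 1 ≤ N' := hN1.trans hNN'
  have hN'r : (N : ℝ) ≤ N' := by exact_mod_cast hNN'
  have hN'0 : (0 : ℝ) < N' := by linarith
  have hYN' : Y ≤ N' := (Nat.le_ceil Y).trans (by rw [hN']; exact_mod_cast le_max_right _ _)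
  have hN'C₂ : (N' : ℝ) ≤ C₂ * N := by
    have h1 : (N' : ℝ) ≤ max (N : ℝ) (Y + 1) := by
      rw [hN', Nat.cast_max]
      exact max_le_max le_rfl (Nat.ceil_lt_add_one hY0).le
    have h2 : Y + 1 ≤ C₂ * N := by
      have e1 : C' * C ≤ C' * C * N := le_mul_of_one_le_right (by positivity) hN1r
      have e3 : Y + 1 = C' * N + C' * C + C' * t * X₁ * N + 1 := by rw [hY]; ring
      have e4 : C₂ * N = 2 * N + C' * N + C' * C * N + C' * t * X₁ * N := by rw [hC₂]; ring
      rw [e3, e4]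
      linarith
    have h3 : (N : ℝ) ≤ C₂ * N := le_mul_of_one_le_left hN0r.le hC₂1
    exact h1.trans (max_le h3 h2)
  -- the preimage body `K'` and its box
  have hK'box : {c : Fin (kerDim A) → ℝ | realMap (paramSystem A x₀) c ∈ K} ⊆
      realBox (kerDim A) (N' : ℝ) := by
    intro c hc
    refine mem_realBox_of_abs_le fun j => ?_
    have h1 : ∀ i, |(paramSystem A x₀ i).realEval c| ≤ N := fun i =>
      abs_le_of_mem_realBox (hKN hc) i
    exact (hbox x₀ c N (C + t * (X₁ * N)) hN0r.le (by positivity) h1 hx₀bd j).trans hYN'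
  have hK'c : Convex ℝ {c : Fin (kerDim A) → ℝ | realMap (paramSystem A x₀) c ∈ K} :=
    convex_preimage_realMap _ hKc
  -- hypotheses of the Main Theorem for `Ψ` at scale `N'`
  have hcx : complexity (paramSystem A x₀) ≤ (s : ℕ) := complexity_paramSystem_le hA hnd x₀
  have hndΨ : IsNondegenerateSystem (paramSystem A x₀) := isNondegenerateSystem_of_complexity_le hcx
  have hszΨ : affLinSize (paramSystem A x₀) N' ≤ Lm := by
    have h1 := hsize N' hN'0
    have h2 : t * (C * (1 + ∑ k, |(b k : ℝ)|)) / N' ≤ t * X₁ := by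
      rw [div_le_iff₀ hN'0]
      calc t * (C * (1 + ∑ k, |(b k : ℝ)|)) ≤ t * (X₁ * N) :=
            mul_le_mul_of_nonneg_left hCb (by positivity)
        _ ≤ t * (X₁ * N') := by gcongr
        _ = t * X₁ * N' := by ring
    calc affLinSize (paramSystem A x₀) N' ≤ C + t * (C * (1 + ∑ k, |(b k : ℝ)|)) / N' := h1
      _ ≤ C + t * X₁ := add_le_add le_rfl h2
      _ ≤ Lm := Nat.le_ceil _
  have hmainΨ := hN₁ N' (hNN₁.trans hNN') (paramSystem A x₀) hndΨ hcx hszΨ _ hK'c hK'box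
  -- transport the three quantities
  have hsum := vonMangoldtSum_paramSystem_eq hx₀ hKN hK'box
  have hsp : singularProduct (paramSystem A x₀) = equationSingularProduct A b :=
    (equationSingularProduct_eq hx₀).symm
  have hcount := equationArchCount_eq_card (N' := N') hx₀ hKN hK'box
  obtain ⟨hle1, hle2⟩ := posCount_le_card_and_le hnd x₀ K N'
  have hpc : |(posCount A x₀ K N' : ℝ) - (equationArchCount A b K N : ℝ)| ≤
      t * (2 * (N' : ℝ) + 1) ^ (kerDim A - 1) := by
    rw [hcount]
    have h1 := (Nat.cast_le (α := ℝ)).mpr hle1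
    have h2 := (Nat.cast_le (α := ℝ)).mpr hle2
    push_cast at h2
    rw [abs_sub_comm, abs_of_nonneg (by linarith)]
    linarith
  -- `β_∞` versus the open count, by the lattice-point theorem for `K' ∩ {Ψ_ℝ > 0}`
  have hKpos : Convex ℝ {c : Fin (kerDim A) → ℝ |
      realMap (paramSystem A x₀) c ∈ K ∩ {x | ∀ i, 0 < x i}} :=
    convex_preimage_realMap _ (hKc.inter (convex_posOrthant t))
  have hKpos_box : {c : Fin (kerDim A) → ℝ |
      realMap (paramSystem A x₀) c ∈ K ∩ {x | ∀ i, 0 < x i}} ⊆ realBox (kerDim A) (N' : ℝ) :=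
    fun c hc => hK'box hc.1
  have harch : archFactor (paramSystem A x₀) {c | realMap (paramSystem A x₀) c ∈ K} =
      (volume {c : Fin (kerDim A) → ℝ |
        realMap (paramSystem A x₀) c ∈ K ∩ {x | ∀ i, 0 < x i}}).toReal := by
    unfold archFactor
    rfl
  have hlatt : |((posCount A x₀ K N' : ℕ) : ℝ) - (volume {c : Fin (kerDim A) → ℝ |
      realMap (paramSystem A x₀) c ∈ K ∩ {x | ∀ i, 0 < x i}}).toReal| ≤
      Cd * (N' : ℝ) ^ (kerDim A - 1) := by
    have h := hlat N' hN'1 _ hKpos hKpos_box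
    unfold posCount
    convert h using 6
  have hlatt' : |archFactor (paramSystem A x₀) {c | realMap (paramSystem A x₀) c ∈ K} -
      (posCount A x₀ K N' : ℝ)| ≤ Cd * (N' : ℝ) ^ (kerDim A - 1) := by
    rw [harch, abs_sub_comm]
    exact hlatt
  -- singular product bounds
  obtain ⟨hS0, hSB⟩ := hB (kerDim A) (paramSystem A x₀) hndΨ
    (isFiniteComplexitySystem_paramSystem hnd x₀) (hcoeff x₀)
  -- assemble
  have key : |equationVonMangoldtSum A b K N -
      equationArchCount A b K N * equationSingularProduct A b| ≤
      ε' * (N' : ℝ) ^ kerDim A +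
        (Cd * (N' : ℝ) ^ (kerDim A - 1) + t * (2 * (N' : ℝ) + 1) ^ (kerDim A - 1)) * B := by
    rw [← hsum, ← hsp]
    exact abs_sub_mul_le hmainΨ hlatt' hpc hS0 hSB
  calc |equationVonMangoldtSum A b K N - equationArchCount A b K N * equationSingularProduct A b|
      ≤ ε' * (N' : ℝ) ^ kerDim A +
          (Cd * (N' : ℝ) ^ (kerDim A - 1) + t * (2 * (N' : ℝ) + 1) ^ (kerDim A - 1)) * B := key
    _ ≤ ε * (N : ℝ) ^ kerDim A := hbook N hNNb N' hN'1 hN'C₂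
    _ = ε * (N : ℝ) ^ (t - s) := by rw [hdts]

/-! ### Theorem 1.8 from the Main Theorem: uniformly in `A` -/

/-- **Green–Tao 2010, §4: the Main Theorem at complexity `s` implies Theorem 1.8 at complexity
`s`**, uniformly over all `s × t` integer matrices with entries bounded by `L` (a finite set).
[cite: GreenTao2010, §4 (derivation of Thm. 1.8)] -/
theorem GreenTao2010_theorem18_of_mainTheoremAtComplexity (s : ℕ)
    (hmain : GreenTao2010_mainTheoremAtComplexity s) : GreenTao2010_theorem18AtComplexity s := by
  classical
  intro t L hst ε hε
  have hfix : ∀ A : Matrix (Fin s) (Fin t) ℤ, ∃ N₀ : ℕ, (ratMat A).rank = s →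
      RowSpaceNondegenerate A → ∀ N : ℕ, N₀ ≤ N → ∀ b : Fin s → ℤ, (∃ x : Fin t → ℤ, A *ᵥ x = b) →
        (∀ k, |b k| ≤ L * N) → ∀ K : Set (Fin t → ℝ), Convex ℝ K → K ⊆ realBox t N →
          |equationVonMangoldtSum A b K N -
              equationArchCount A b K N * equationSingularProduct A b| ≤
            ε * (N : ℝ) ^ (t - s) := by
    intro A
    by_cases hA : (ratMat A).rank = s
    · by_cases hnd : RowSpaceNondegenerate A
      · obtain ⟨N₀, h⟩ := GreenTao2010_theorem18_fixedMatrix hmain hA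
          (kerOrthNondegenerate_of_rowSpaceNondegenerate hnd) hst L hε
        exact ⟨N₀, fun _ _ => h⟩
      · exact ⟨0, fun _ h => absurd h hnd⟩
    · exact ⟨0, fun h => absurd h hA⟩
  choose N₀ hN₀ using hfix
  -- the matrices with `|a_{ij}| ≤ L` form a finite set
  set S : Set (Matrix (Fin s) (Fin t) ℤ) :=
    Set.pi Set.univ fun _ : Fin s => Set.pi Set.univ fun _ : Fin t => Set.Icc (-(L : ℤ)) L with hS
  have hSfin : S.Finite :=
    Set.Finite.pi fun _ => Set.Finite.pi fun _ => Set.finite_Icc _ _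
  refine ⟨hSfin.toFinset.sup N₀, fun N hN A hA hAL hnd b hb hbL K hKc hKN => ?_⟩
  have hAS : A ∈ hSfin.toFinset := by
    rw [Set.Finite.mem_toFinset]
    exact fun i _ j _ => Set.mem_Icc.mpr (abs_le.mp (hAL i j))
  exact hN₀ A hA hnd N ((Finset.le_sup hAS).trans hN) b hb hbL K hKc hKN

/-- **Green–Tao 2010, Theorem 1.8 at Cauchy–Schwarz complexity 1 — unconditional**: for every
`t ≥ 2`… (the row-space hypothesis forces `t ≥ 3`), every single linear equation
`a₁x₁ + ⋯ + a_t x_t = b` with all 2-element minors of the row `(a₁,…,a_t)` — i.e. all `aᵢ` —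
non-zero, `|aᵢ| ≤ L`, `|b| ≤ LN`, and every convex `K ⊆ [−N, N]^t`, the von Mangoldt-weighted
number of solutions in `K` is `α_∞ ∏_p α_p + o_{t,L}(N^{t−1})`. This contains Vinogradov's
three-primes theorem with general coefficients and Balog's theorem as special cases.
[cite: GreenTao2010, Thm. 1.8 (case `s = 1`, unconditional by §1 "the case s = 1 … is classical")] -/
theorem GreenTao2010_theorem18AtComplexity_one : GreenTao2010_theorem18AtComplexity 1 :=
  GreenTao2010_theorem18_of_mainTheoremAtComplexity 1 GreenTao2010_mainTheoremAtComplexity_one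

open GreenTaoLevelTwo in
/-- **Theorem 1.8 at complexity 2 from `GI(2)` and `MN(2)`** (two simultaneous linear equations,
e.g. four-term progressions / parallelograms in primes inside convex bodies).
[cite: GreenTao2010, Thm. 1.8 (case `s = 2`), Thm. 7.2] -/
theorem GreenTao2010_theorem18AtComplexity_two_of_GI_of_MN (hGI : GITwo) (hMN : MNTwo) :
    GreenTao2010_theorem18AtComplexity 2 :=
  GreenTao2010_theorem18_of_mainTheoremAtComplexity 2
    (GreenTao2010_mainTheoremAtComplexity_two_of_GI_of_MN hGI hMN)

end Literature.NumberTheory.Sieve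

end
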